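import Summits.BirchSwinnertonDyer.Rank1Residual.Additive.X3RankZeroSemistableTwistFactFree
import Summits.BirchSwinnertonDyer.Rank1Residual.Additive.X3RankZeroSemistableTwistOdd
import HarnessLib

/-!
# X3 ∧ `r_an = 0` ∧ (semistable twist by `p*`), ANY odd `p`: one statement for both parities (cell `b2b-bsdres`, seat additive-p4, line V9)

HONEST FRAMING (cell `b2b-bsdres`, run/shared/lean/b2b/bsd-rank1-residual/, verbatim in every
file): the goal of the cell is to DELETE the COMBINATION-SHAPED residual classes of the
Birch–Swinnerton-Dyer formula for ALL analytic-rank `≤ 1` elliptic curves over `ℚ` — "full BSD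
formula for every rank `≤ 1` curve in class `C`" assembled STRICTLY from published theorems — so
that the rank-`≤ 1` remainder becomes exactly the CONSTRUCTION-SHAPED classes, which are TYPED
(missing-input `Prop`s), NOT attempted. This is not "finishing BSD". The additive sub-cell (seats
additive-p1…p4) is a RESEARCH ROUTE on the construction-shaped classes X3/X4; no claim beyond the
stated classes; the label of X3 is UNCHANGED (its one non-published input is TYPED).

Theorems only. A convenience wrapper for consumers (Partition / class bookkeeping): the even
(`X3RankZeroSemistableTwistFactFree.lean`, `p ≡ 1 (mod 4)`) and odd
(`X3RankZeroSemistableTwistOdd.lean`, `p ≡ 3 (mod 4)`) V9 theorems glued into ONE statement for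
every odd prime `p`, with the twist written in the cell's uniform convention
`p* = (−1)^{⌊p/2⌋}·p` (ENGINE T; `E ≅ V ⊗ χ_{p*}`, `V` good ordinary or multiplicative at `p`) and
BOTH typed inputs as hypotheses (only the one of the right parity is used):

* `X3RankZeroTwist.shaOrder_le_of_odd_prime` — `#Ш_an(E) = q ∈ ℚ` with
  `ord_p #Ш(E) ≤ ord_p q + ord_p c_p(E)` (for `p ≡ 1 (mod 4)` the `c_p` term is `0` anyway);
* `X3RankZeroTwist.missingUpperBoundAt_of_odd_prime` — `p ∤ c_p(E)` ⇒ `Typed.MissingUpperBoundAt W p`;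
* `X3RankZeroTwist.bsdp_of_odd_prime_of_shaAn_unit` — plus `p ∤ #Ш_an(E)` ⇒ `BSD(E,p)`.
Inputs: Delbourgo 1998 Prop. 4 (`hDel`), Gross–Zagier–Kolyvagin (`hGZK`), modularity (`hmod`),
the typed [B∘C](0) inputs `ChiBranchLeadingTermAt W p` / `ChiBranchLeadingTermOddAt W p`, the
rational period ratios `ϖ⁺` (`ϖ⁺·Ω_V = Ω⁺_f`, tree `exists_rat_mul_realPeriodRat_eq_plusPeriod`)
and `ϖ⁻` (`ϖ⁻·|Ω⁻(V)| = Ω⁻_f`, `MinusPeriodRatio.lean`).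

References: Delbourgo 1998 [Delbourgo1998] Prop. 4; Miller 2011 [Miller2011LMS] Def. 1.1.
-/

noncomputable section

open scoped Classical MatrixGroups ModularForm

open CongruenceSubgroup WeierstrassCurve Literature.NumberTheory.EllipticCurves
  Literature.NumberTheory.EllipticCurves.ModularForms
  Literature.NumberTheory.EllipticCurves.Rank1Residual

namespace Summit.BirchSwinnertonDyer.Rank1Residual.Additive

section AnyOdd

open IsDedekindDomain NumberField Rat.HeightOneSpectrum
  Literature.NumberTheory.EllipticCurves.Rank1Residual.Typed

variable (W : WeierstrassCurve ℚ) [W.IsElliptic] [W.IsGloballyMinimal] (p : ℕ) [hp : Fact p.Prime]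

omit [W.IsElliptic] [W.IsGloballyMinimal] hp in
/-- `p* = (−1)^{⌊p/2⌋} p` is `p` for `p ≡ 1 (mod 4)` and `−p` for `p ≡ 3 (mod 4)`. -/
theorem pStar_eq_of_mod_four (hodd : p % 4 = 1 ∨ p % 4 = 3) :
    ((-1 : ℚ) ^ (p / 2) * p) = if p % 4 = 1 then (p : ℚ) else -(p : ℚ) := by
  rcases hodd with h | h
  · rw [if_pos h, show ((-1 : ℚ) ^ (p / 2)) = (((-1 : ℤ) ^ (p / 2) : ℤ) : ℚ) by push_cast; ring,
      neg_one_pow_half_eq_one_of_mod_four_eq_one p h]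
    push_cast
    ring
  · rw [if_neg (by omega), show ((-1 : ℚ) ^ (p / 2)) = (((-1 : ℤ) ^ (p / 2) : ℤ) : ℚ) by push_cast; ring,
      neg_one_pow_half_eq_neg_one_of_mod_four_eq_three p h]
    push_cast
    ring

/-- **V9 for every odd prime (both parities glued).** On X3 ∧ `r_an = 0` with
`W = C • V^{(p*)}`, `p* = (−1)^{⌊p/2⌋} p`, `V` globally minimal good ordinary or multiplicative at
the odd prime `p`, `f` the newform of `V`, rational `ϖ⁺, ϖ⁻` with `ϖ⁺·Ω_V = Ω⁺_f`,
`ϖ⁻·|Ω⁻(V)| = Ω⁻_f`, granted the typed inputs of BOTH parities (only the relevant one is used):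
`#Ш_an(E) = q ∈ ℚ` with **`ord_p #Ш(E) ≤ ord_p q + ord_p c_p(E)`**, from Delbourgo 1998 Prop. 4,
GZK, modularity and tree theorems. -/
theorem X3RankZeroTwist.shaOrder_le_of_odd_prime
    (hDel : Delbourgo1998.prop4_rankZero_pow_dvd_constantCoeff)
    (hGZK : rank_eq_analyticRank_of_analyticRank_le_one) (hmod : hasEntireLFunction_rat)
    (hBCeven : ChiBranchLeadingTermAt W p) (hBCodd : ChiBranchLeadingTermOddAt W p)
    (hp2 : p ≠ 2) (hr : W.analyticRank = 0) (hX : ClassX3 W p)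
    (V : WeierstrassCurve ℚ) [V.IsElliptic] [V.IsGloballyMinimal]
    (C : VariableChange ℚ) (hC : C • V.quadraticTwist ((-1 : ℚ) ^ (p / 2) * p) = W)
    (hV : GoodOrd V p ∨ Mult V p)
    {N : ℕ} [NeZero N] {f : CuspForm (Gamma0 N) 2} (hf : IsNewformOf V f)
    (ϖp : ℚ) (hϖp : (ϖp : ℝ) * V.realPeriodRat = plusPeriod f)
    (ϖm : ℚ) (hϖm : (ϖm : ℝ) * V.imaginaryPeriodRat = minusPeriod f) :
    ∃ q : ℚ, shaAn W = (q : ℂ) ∧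
      (padicValNat p W.shaOrder : ℤ) ≤
        padicValRat p q + padicValNat p (W.tamagawaNumberAt ((primesEquiv (R := 𝓞 ℚ)).symm ⟨p, hp.out⟩)) := by
  have hodd : p % 4 = 1 ∨ p % 4 = 3 := by
    obtain ⟨k, hk⟩ := hp.out.odd_of_ne_two hp2
    omega
  rcases hodd with h1 | h3
  · have hC' : C • V.quadraticTwist (p : ℚ) = W := by
      rw [pStar_eq_of_mod_four p (Or.inl h1), if_pos h1] at hC
      exact hC
    obtain ⟨q, hq, hle⟩ := X3RankZeroTwist.missingUpperBoundAt_factFree W p hDel hGZK hmod hBCeven h1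
      hr hX V C hC' hV hf ϖp hϖp
    refine ⟨q, hq, ?_⟩
    have h0 : (0 : ℤ) ≤ (padicValNat p (W.tamagawaNumberAt
        ((primesEquiv (R := 𝓞 ℚ)).symm ⟨p, hp.out⟩)) : ℤ) := Nat.cast_nonneg _
    linarith
  · have hC' : C • V.quadraticTwist (-(p : ℚ)) = W := by
      rw [pStar_eq_of_mod_four p (Or.inr h3), if_neg (by omega)] at hC
      exact hC
    exact X3RankZeroTwistOdd.shaOrder_le W p hDel hGZK hmod hBCodd h3 hr hX V C hC' hV hf ϖm hϖm

/-- **`Typed.MissingUpperBoundAt W p` for every odd prime** (same hypotheses) whenever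
`p ∤ c_p(E)` — automatic for `p ≥ 5` (`c_p ≤ 4`); at `p = 3` the per-pair bit `c_3 ∈ {1,2,4}`. -/
theorem X3RankZeroTwist.missingUpperBoundAt_of_odd_prime
    (hDel : Delbourgo1998.prop4_rankZero_pow_dvd_constantCoeff)
    (hGZK : rank_eq_analyticRank_of_analyticRank_le_one) (hmod : hasEntireLFunction_rat)
    (hBCeven : ChiBranchLeadingTermAt W p) (hBCodd : ChiBranchLeadingTermOddAt W p)
    (hp2 : p ≠ 2) (hr : W.analyticRank = 0) (hX : ClassX3 W p)
    (V : WeierstrassCurve ℚ) [V.IsElliptic] [V.IsGloballyMinimal]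
    (C : VariableChange ℚ) (hC : C • V.quadraticTwist ((-1 : ℚ) ^ (p / 2) * p) = W)
    (hV : GoodOrd V p ∨ Mult V p)
    {N : ℕ} [NeZero N] {f : CuspForm (Gamma0 N) 2} (hf : IsNewformOf V f)
    (ϖp : ℚ) (hϖp : (ϖp : ℝ) * V.realPeriodRat = plusPeriod f)
    (ϖm : ℚ) (hϖm : (ϖm : ℝ) * V.imaginaryPeriodRat = minusPeriod f)
    (htam : ¬ p ∣ W.tamagawaNumberAt ((primesEquiv (R := 𝓞 ℚ)).symm ⟨p, hp.out⟩)) :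
    MissingUpperBoundAt W p := by
  obtain ⟨q, hq, hle⟩ := X3RankZeroTwist.shaOrder_le_of_odd_prime W p hDel hGZK hmod hBCeven hBCodd
    hp2 hr hX V C hC hV hf ϖp hϖp ϖm hϖm
  refine ⟨q, hq, ?_⟩
  rw [padicValNat.eq_zero_of_not_dvd htam, Nat.cast_zero, add_zero] at hle
  exact hle

/-- **`BSD(E,p)` for every odd prime on the rows with `p ∤ c_p(E)·#Ш_an(E)`** (same hypotheses). -/
theorem X3RankZeroTwist.bsdp_of_odd_prime_of_shaAn_unit
    (hDel : Delbourgo1998.prop4_rankZero_pow_dvd_constantCoeff)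
    (hGZK : rank_eq_analyticRank_of_analyticRank_le_one) (hmod : hasEntireLFunction_rat)
    (hBCeven : ChiBranchLeadingTermAt W p) (hBCodd : ChiBranchLeadingTermOddAt W p)
    (hp2 : p ≠ 2) (hr : W.analyticRank = 0) (hX : ClassX3 W p)
    (V : WeierstrassCurve ℚ) [V.IsElliptic] [V.IsGloballyMinimal]
    (C : VariableChange ℚ) (hC : C • V.quadraticTwist ((-1 : ℚ) ^ (p / 2) * p) = W)
    (hV : GoodOrd V p ∨ Mult V p)
    {N : ℕ} [NeZero N] {f : CuspForm (Gamma0 N) 2} (hf : IsNewformOf V f)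
    (ϖp : ℚ) (hϖp : (ϖp : ℝ) * V.realPeriodRat = plusPeriod f)
    (ϖm : ℚ) (hϖm : (ϖm : ℝ) * V.imaginaryPeriodRat = minusPeriod f)
    (htam : ¬ p ∣ W.tamagawaNumberAt ((primesEquiv (R := 𝓞 ℚ)).symm ⟨p, hp.out⟩))
    {q : ℚ} (hq : shaAn W = (q : ℂ)) (hv : padicValRat p q = 0) : BSDp W p :=
  bsdp_of_missingPPartAt W p hGZK (by rw [hr]; exact zero_le_one)
    (missingPPartAt_of_upper_of_shaAn_unit W p
      (X3RankZeroTwist.missingUpperBoundAt_of_odd_prime W p hDel hGZK hmod hBCeven hBCodd hp2 hr hX V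
        C hC hV hf ϖp hϖp ϖm hϖm htam) hq hv)

end AnyOdd

end Summit.BirchSwinnertonDyer.Rank1Residual.Additive

end
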